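/-
COR-CM (cell pub-hodgecm2, stage 2 of the Hodge ladder) — X_Γ-side junction «HODGE BLOCK ⇒ `U_Ψ ≠ 0`», the ALBANESE STEP
of the supply leaf B01-S in the kernel: on the universe of record `picardCMUniverse hHD hI h₁ h₃`, a non-zero rational
`K`-block `W ⊆ H¹(P_Γ(ℂ); ℚ)` of the realised Picard modular surface `P_Γ` whose complexified `σ`-eigenvectors are all of
Hodge type `(1,0)` for `σ ∈ Ψ` and all of type `(0,1)` for `σ ∉ Ψ` FORCES `U_Ψ(Γ)_σ ≠ 0` for every `σ ∈ Ψ`; hence B01-S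
`FaceSupply U_rec` follows from the existence, for every face datum, of such blocks of the two slot types at one level.
Written by the binder seat pub-hodgecm2-b10 (prover-pub-hodgecm2-b10-g20-0), count-neutral own lane ALB-H1-ISO, over
its `CorCM/Geometry/AlbaneseRangeBallQuotient` (p260683 RANGE-FREE at `P_Γ`: the analytic Albanese of the compact ball
quotient, algebraised) and own-b01's `CorCM/B01/FaceSupplyAlbaneseHom` (B01-S through the Albanese).  Theorems only;
nothing cited as a record; nothing asserted; no binder row touched; nothing under `CorCM/B01/` edited or restated; not a
display of record; HC_CM is NOT proved; the wording of record is unchanged.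
-/
import Summits.HodgeConjecture.CorCM.Geometry.AlbaneseRangeBallQuotient
import Summits.HodgeConjecture.CorCM.B01.FaceSupplyAlbaneseHom
import Summits.HodgeConjecture.CorCM.B01.LevelCovering
import Summits.HodgeConjecture.CorCM.B01.UisoInflationRec
import Summits.HodgeConjecture.CorCM.Model.CMProdBiproduct
import Summits.HodgeConjecture.CorCM.B01.FaceInputsSplit
import Summits.HodgeConjecture.CorCM.UisoLevelMonotone
import Summits.HodgeConjecture.CorCM.CM.Lemmas
import Literature.AlgebraicGeometry.ComplexMultiplication.ShimuraIsogenyHolds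
import Literature.AlgebraicGeometry.ComplexMultiplication.ShimuraInflationBettiJunctions
import HarnessLib

/-!
# Hodge blocks in `H¹(P_Γ; ℚ)` force `U_Ψ(Γ) ≠ 0` — the Albanese step of B01-S

ON THE UNIVERSE OF RECORD `U_rec = picardCMUniverse hHD hI h₁ h₃`.  Put `P_Γ = Var.scheme hU h₃ (.pms (pmsCode L ι₁ V Γ))`
(`hU = ballQuotientUniformisedDatum_of h₁`), a compact ball quotient as soon as `2 < [L:ℚ]`
(`Model.isAnisotropic_pmsCode_of_two_lt`).  A **Hodge block of type `(K; Ψ)`** in `H¹(P_Γ(ℂ); ℚ)` is a non-zero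
`ℚ`-subspace `W` with a `ℚ`-algebra action `ρ : K → End_ℚ W` of the CM field `K` such that, for every complex
embedding `σ` of `K`, the joint `σ`-eigenvectors of `ρ ⊗ ℂ` in `ℂ ⊗ W ⊆ H¹(P_Γ(ℂ); ℂ)` are ALL of Hodge type `(1,0)`
when `σ ∈ Ψ` and ALL of type `(0,1)` when `σ ∉ Ψ` (in print: the `ℚ`-span of a Hecke-isotypic family of holomorphic
one-forms and their conjugates, with its field of Hecke eigenvalues; or the `H¹` of a CM isogeny factor of `Alb P_Γ`).

* `cmType_eq_of_subset` — a CM type contained in another equals it (`Domination.cmTypeMap_symm_cmTypeMap` of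
  `Model/CMProdBiproduct` is reused for the transport of types, not restated).
* **`picardCMUniverse_Uiso_ne_bot_of_hom_realisation_ne_zero`** — ANY realisation will do: for `σ ∈ Ψ`, a
  realisation `(A, ι, θ)` of `(K; Ψ)` (`IsCMTypeRealisation`) and a non-zero `u : Alb(P_Γ) → A` give `U_Ψ(Γ)_σ ≠ 0`
  (Shimura's isogeny `A → A_{(K,Ψ)}` onto the chosen realisation, `Shimura1998_Thm2_Cor_holds`, is bijective on
  `H¹(−; ℚ)`, `isogeny_bettiMap_bijective_holds`; then own-b01's row D0 through the Albanese).
* **`picardCMUniverse_exists_cmType_Uiso_ne_bot_of_allOrNothing_submodule`** — an ALL-OR-NOTHING block (every `σ`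
  has all its eigenvectors of type `(1,0)` or all of type `(0,1)`) determines a CM type `Φ` of `K` (the `σ` of type
  `(1,0)`) with `U_Φ(Γ)_σ ≠ 0` for every `σ ∈ Φ`: `Model.exists_cmType_hom_ne_zero_of_allOrNothing_submodule_pms`
  (p260683 made range-free at `P_Γ` by the analytic Albanese, `Geometry/AlbaneseRangeBallQuotient`) applied to the
  chosen realisation `A_{(K,Φ)}` read over `K` (`Model.isCMTypeRealisation_cmCode`, transported along
  `cmCodeEquiv K Φ`), then own-b01's `picardCMUniverse_Uiso_ne_bot_iff_exists_hom_ne_zero` (row D0 through the Albanese).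
* **`picardCMUniverse_Uiso_ne_bot_of_hodgeBlock`** — a Hodge block of type `(K; Ψ)` gives `U_Ψ(Γ)_σ ≠ 0` for all
  `σ ∈ Ψ` (the CM type read off the block is `Ψ`, by `cmType_eq_of_subset`).
* **`picardCMUniverse_faceSupply_of_hodgeBlocks`** — B01-S `FaceSupply U_rec` from: for every face datum
  `(F, f, ι₁, V)` (`F` Galois CM of degree `≥ 6`, `ι₁` admissible) some level `Γ` carries Hodge blocks of types
  `(F; ψ₀)` and `(F; ψ₁)` in `H¹(P_Γ(ℂ); ℚ)` (`ι₁ ∈ ψ₀ ∩ ψ₁` by `admissible_mem_psi`).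
* **`picardCMUniverse_faceSupply_of_hodgeBlocks_slotwise`** — the same with the two blocks at possibly DIFFERENT levels
  `Γ₀`, `Γ₁` (b07's `faceSupply_iff_slotwise`: supply persists to the common finer level `Γ₀ ⊓ Γ₁`).
* `picardCMUniverse_exists_supply_of_hodgeBlocks` — the `∃ ι₁ ∃ V ∃ Γ` (witness) form consumed by the transposition
  item (vi): Hodge blocks of the two slot types at ONE `(ι₁, V, Γ)` per face give non-zero classes of `U_{ψ₀}(Γ)_{ι₁}`,
  `U_{ψ₁}(Γ)_{ι₁}` there.

So the X_Γ-GEOMETRY of the supply leaf is discharged down to RATIONAL HODGE BLOCKS: what remains of B01-S is to produce,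
for the two slot types of every face, a non-zero `F`-stable rational sub-Hodge structure of `H¹(P_Γ; ℚ)` of that CM
type — in print the Hecke/theta-correspondence bookkeeping ([Liu2021] Thm. 4.18 (2)–(3), Cor. 4.20; for Picard modular
surfaces Murty–Ramakrishnan), which is automorphic and not claimed here.
-/

noncomputable section

open scoped TensorProduct
open CategoryTheory Module NumberField

namespace Summit.HodgeConjecture.CorCM

open Literature.AlgebraicGeometry.Motives
open Literature.AlgebraicGeometry.HodgeTheory
open Literature.AlgebraicGeometry.ComplexMultiplication
  (IsCMTypeRealisation Shimura1998_Thm2_Cor_holds isogeny_bettiMap_bijective_holds)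
open Literature.NumberTheory.Automorphic.PicardCM

/-- **A CM type contained in another CM type equals it**: if `Ψ ⊆ Φ` and `σ ∈ Φ ∖ Ψ` then `σ̄ ∈ Ψ ⊆ Φ`, so `Φ` would
contain the conjugate pair `{σ, σ̄}`. -/
theorem cmType_eq_of_subset {K : Type*} [Field K] {Ψ Φ : CMType K} (h : Ψ.1 ⊆ Φ.1) : Ψ = Φ := by
  refine Subtype.ext (Set.Subset.antisymm h fun σ hσ => ?_)
  by_contra hσΨ
  have hconj : ComplexEmbedding.conjugate σ ∈ Ψ.1 := by
    have h2 := Ψ.2 (ComplexEmbedding.conjugate σ)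
    have hcc : ComplexEmbedding.conjugate (ComplexEmbedding.conjugate σ) = σ := RingHom.ext fun x => by
      simp
    rw [hcc] at h2
    exact h2.2 hσΨ
  exact (Φ.2 σ).1 hσ (h hconj)

namespace Model

variable {hHD : exists_isReal_hodgeModel} {hI : hodgePQ_independent_of_hodgeModel}
  {h₁ : BallQuotientUniformised} {h₃ : CMAbelianVarietyRealised}

variable (h₃) in
/-- **The chosen realisation `A_{(K,Φ)}` read over `K` realises `(K; Φ)`**: `(cmRealisation h₃ (cmCode K Φ)).AV` with its
actions pulled back along `cmCodeEquiv K Φ : K ≃+* (cmCode K Φ).E` satisfies `IsCMTypeRealisation Φ`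
(`Model.isCMTypeRealisation_cmCode` transported along `(cmCodeEquiv K Φ)⁻¹`, the type rewritten by
`Domination.cmTypeMap_symm_cmTypeMap`). -/
theorem isCMTypeRealisation_cmCode_over (K : CMField) (Φ : CMType K) :
    IsCMTypeRealisation Φ (cmRealisation h₃ (cmCode K Φ)).AV
      ((cmRealisation h₃ (cmCode K Φ)).ι.comp
        (RingOfIntegers.mapRingEquiv (cmCodeEquiv K Φ).symm.symm).toRingHom)
      ((cmRealisation h₃ (cmCode K Φ)).θ.comp (cmCodeEquiv K Φ).symm.symm.toRingHom) := by
  have hR := (isCMTypeRealisation_cmCode h₃ K Φ).transport (cmCodeEquiv K Φ).symm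
  rwa [show CMCode.cmTypeMap (cmCodeEquiv K Φ).symm (cmCode K Φ).Φ = Φ from
    Domination.cmTypeMap_symm_cmTypeMap (cmCodeEquiv K Φ) Φ] at hR

/-- **Any realisation will do.**  For `σ ∈ Ψ`, an Albanese datum `𝒥` of `P_Γ`, ANY realisation `(A, ι, θ)` of the
CM type `(K; Ψ)` read on `H¹` and a non-zero homomorphism `u : Alb(P_Γ) → A`: `U_Ψ(Γ)_σ ≠ ⊥`.  (Shimura's
isogeny `g : A → A_{(K,Ψ)}` onto the CHOSEN realisation read over `K` — `Shimura1998_Thm2_Cor_holds` with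
`isCMTypeRealisation_cmCode_over` — is bijective on `H¹(−(ℂ); ℚ)` (`isogeny_bettiMap_bijective_holds`), so
`(f^P ≫ u ≫ g)^* = (f^P ≫ u)^* ∘ g^* ≠ 0` (`Jacobian.hom_bettiCohomology_map_abelJacobi_comp_ne_zero_of_ne_zero`);
hence `Hom(Alb(P_Γ), A_{(K,Ψ)}) ≠ 0` (`Jacobian.exists_hom_bettiCohomology_map_ne_zero_iff_exists_hom_ne_zero`) and
own-b01's `picardCMUniverse_Uiso_ne_bot_iff_exists_hom_ne_zero` concludes.) -/
theorem picardCMUniverse_Uiso_ne_bot_of_hom_realisation_ne_zero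
    {L : CMField} {ι₁ : L →+* ℂ} {V : HermSpace3 L ι₁} (Γ : Level V) (K : CMField) (Ψ : CMType K)
    {σ : K →+* ℂ} (hσ : σ ∈ Ψ.1)
    (𝒥 : Jacobian (Var.scheme (ballQuotientUniformisedDatum_of h₁) h₃ (.pms (pmsCode L ι₁ V Γ))))
    {A : AbelianVariety ℂ} {ιA : 𝓞 K →+* End A} {θ : K →+* Module.End ℂ (complexBetti A.X 1)}
    (hA : IsCMTypeRealisation Ψ A ιA θ) (u : 𝒥.J ⟶ A) (hu : u ≠ 0) :
    (picardCMUniverse hHD hI h₁ h₃).Uiso Γ K Ψ σ ≠ ⊥ := by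
  have hX := Var.isSmoothProjective (ballQuotientUniformisedDatum_of h₁) h₃ (.pms (pmsCode L ι₁ V Γ))
  obtain ⟨P⟩ := hX.nonempty_algPoints ℂ
  obtain ⟨g, hg, -⟩ :=
    Shimura1998_Thm2_Cor_holds K Ψ A ιA θ _ _ _ hA (isCMTypeRealisation_cmCode_over h₃ K Ψ)
  have hF := 𝒥.hom_bettiCohomology_map_abelJacobi_comp_ne_zero_of_ne_zero P A hX u hu
  have hF' : (bettiCohomology.map ((𝒥.abelJacobi P ≫ u.hom.hom.hom) ≫ g.hom.hom.hom) 1).hom ≠ 0 := by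
    rw [bettiCohomology.map_comp, ModuleCat.hom_comp]
    intro h
    apply hF
    refine LinearMap.ext fun x => ?_
    obtain ⟨y, rfl⟩ := (isogeny_bettiMap_bijective_holds A _ g hg).2 x
    have hy := LinearMap.congr_fun h y
    rw [LinearMap.comp_apply, LinearMap.zero_apply] at hy
    rw [LinearMap.zero_apply]
    exact hy
  obtain ⟨u', hu'⟩ := (𝒥.exists_hom_bettiCohomology_map_ne_zero_iff_exists_hom_ne_zero
    (cmRealisation h₃ (cmCode K Ψ)).AV hX).1 ⟨_, hF'⟩
  exact (picardCMUniverse_Uiso_ne_bot_iff_exists_hom_ne_zero Γ K Ψ hσ 𝒥).2 ⟨u', hu'⟩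

/-- **An all-or-nothing `K`-block in `H¹(P_Γ; ℚ)` determines a CM type `Φ` with `U_Φ(Γ)_σ ≠ 0` for all `σ ∈ Φ`.**
For `2 < [L:ℚ]`, a level `Γ` of `(L, ι₁, V)`, a CM field `K`, and a non-zero `ℚ`-subspace `W ⊆ H¹(P_Γ(ℂ); ℚ)` with a
`ℚ`-algebra action `ρ` of `K` whose complexified joint `σ`-eigenvectors are, for every `σ`, ALL of Hodge type `(1,0)` or
ALL of type `(0,1)`: the `σ` of type `(1,0)` form a CM type `Φ` of `K`, and `U_Φ(Γ)_σ ≠ ⊥` for every `σ ∈ Φ`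
(`exists_cmType_hom_ne_zero_of_allOrNothing_submodule_pms` at the chosen realisation `A_{(K,Φ)}` read over `K`, then
`picardCMUniverse_Uiso_ne_bot_iff_exists_hom_ne_zero`). -/
theorem picardCMUniverse_exists_cmType_Uiso_ne_bot_of_allOrNothing_submodule
    {L : CMField} {ι₁ : L →+* ℂ} {V : HermSpace3 L ι₁} (hL : 2 < Module.finrank ℚ L) (Γ : Level V)
    (K : CMField)
    (W : Submodule ℚ (bettiCohomology
      (Var.scheme (ballQuotientUniformisedDatum_of h₁) h₃ (.pms (pmsCode L ι₁ V Γ))) 1))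
    (ρ : K →ₐ[ℚ] Module.End ℚ W) (hW : W ≠ ⊥)
    (haon : ∀ σ : K →+* ℂ,
      (∀ t : ℂ ⊗[ℚ] W, (∀ a : K, (ρ a).baseChange ℂ t = (σ a : ℂ) • t) →
        IsOfHodgeType 2 (Var.scheme (ballQuotientUniformisedDatum_of h₁) h₃ (.pms (pmsCode L ι₁ V Γ))) 1 1 0
          (ofRatClassBaseChange
            (ComplexPoints (Var.scheme (ballQuotientUniformisedDatum_of h₁) h₃ (.pms (pmsCode L ι₁ V Γ)))) 1
            (W.subtype.baseChange ℂ t))) ∨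
      (∀ t : ℂ ⊗[ℚ] W, (∀ a : K, (ρ a).baseChange ℂ t = (σ a : ℂ) • t) →
        IsOfHodgeType 2 (Var.scheme (ballQuotientUniformisedDatum_of h₁) h₃ (.pms (pmsCode L ι₁ V Γ))) 1 0 1
          (ofRatClassBaseChange
            (ComplexPoints (Var.scheme (ballQuotientUniformisedDatum_of h₁) h₃ (.pms (pmsCode L ι₁ V Γ)))) 1
            (W.subtype.baseChange ℂ t)))) :
    ∃ Φ : CMType K,
      (∀ σ : K →+* ℂ, σ ∈ Φ.1 ↔
        ∀ t : ℂ ⊗[ℚ] W, (∀ a : K, (ρ a).baseChange ℂ t = (σ a : ℂ) • t) →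
          IsOfHodgeType 2 (Var.scheme (ballQuotientUniformisedDatum_of h₁) h₃ (.pms (pmsCode L ι₁ V Γ))) 1 1 0
            (ofRatClassBaseChange
              (ComplexPoints (Var.scheme (ballQuotientUniformisedDatum_of h₁) h₃ (.pms (pmsCode L ι₁ V Γ)))) 1
              (W.subtype.baseChange ℂ t))) ∧
      ∀ σ : K →+* ℂ, σ ∈ Φ.1 → (picardCMUniverse hHD hI h₁ h₃).Uiso Γ K Φ σ ≠ ⊥ := by
  have hX := Var.isSmoothProjective (ballQuotientUniformisedDatum_of h₁) h₃ (.pms (pmsCode L ι₁ V Γ))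
  obtain ⟨𝒥⟩ := nonempty_jacobian_of_isSmoothProjective_complex_of_dim _ hX
  obtain ⟨P⟩ := hX.nonempty_algPoints ℂ
  obtain ⟨Φ, hΦ, hreach⟩ := exists_cmType_hom_ne_zero_of_allOrNothing_submodule_pms
    (pmsCode L ι₁ V Γ) (isAnisotropic_pmsCode_of_two_lt hL Γ) 𝒥 P W ρ hW haon
  refine ⟨Φ, hΦ, fun σ hσ => ?_⟩
  have hR := isCMTypeRealisation_cmCode_over h₃ K Φ
  obtain ⟨u, hu, -⟩ := hreach _ _ _ hR hR.isInducedOnIntegers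
  exact (picardCMUniverse_Uiso_ne_bot_iff_exists_hom_ne_zero Γ K Φ hσ 𝒥).2 ⟨u, hu⟩

/-- **A Hodge block of type `(K; Ψ)` in `H¹(P_Γ; ℚ)` forces `U_Ψ(Γ)_σ ≠ 0` for every `σ ∈ Ψ`.**  For `2 < [L:ℚ]`, a level
`Γ`, a CM field `K` with a CM type `Ψ`, and a non-zero `ℚ`-subspace `W ⊆ H¹(P_Γ(ℂ); ℚ)` with a `ℚ`-algebra action `ρ`
of `K` whose complexified joint `σ`-eigenvectors are all of Hodge type `(1,0)` for `σ ∈ Ψ` and all of type `(0,1)` for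
`σ ∉ Ψ`: `U_Ψ(Γ)_σ ≠ ⊥` for every `σ ∈ Ψ` (the CM type read off the block by
`picardCMUniverse_exists_cmType_Uiso_ne_bot_of_allOrNothing_submodule` contains `Ψ`, hence equals it). -/
theorem picardCMUniverse_Uiso_ne_bot_of_hodgeBlock
    {L : CMField} {ι₁ : L →+* ℂ} {V : HermSpace3 L ι₁} (hL : 2 < Module.finrank ℚ L) (Γ : Level V)
    (K : CMField) (Ψ : CMType K)
    (W : Submodule ℚ (bettiCohomology
      (Var.scheme (ballQuotientUniformisedDatum_of h₁) h₃ (.pms (pmsCode L ι₁ V Γ))) 1))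
    (ρ : K →ₐ[ℚ] Module.End ℚ W) (hW : W ≠ ⊥)
    (h10 : ∀ σ : K →+* ℂ, σ ∈ Ψ.1 →
      ∀ t : ℂ ⊗[ℚ] W, (∀ a : K, (ρ a).baseChange ℂ t = (σ a : ℂ) • t) →
        IsOfHodgeType 2 (Var.scheme (ballQuotientUniformisedDatum_of h₁) h₃ (.pms (pmsCode L ι₁ V Γ))) 1 1 0
          (ofRatClassBaseChange
            (ComplexPoints (Var.scheme (ballQuotientUniformisedDatum_of h₁) h₃ (.pms (pmsCode L ι₁ V Γ)))) 1
            (W.subtype.baseChange ℂ t)))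
    (h01 : ∀ σ : K →+* ℂ, σ ∉ Ψ.1 →
      ∀ t : ℂ ⊗[ℚ] W, (∀ a : K, (ρ a).baseChange ℂ t = (σ a : ℂ) • t) →
        IsOfHodgeType 2 (Var.scheme (ballQuotientUniformisedDatum_of h₁) h₃ (.pms (pmsCode L ι₁ V Γ))) 1 0 1
          (ofRatClassBaseChange
            (ComplexPoints (Var.scheme (ballQuotientUniformisedDatum_of h₁) h₃ (.pms (pmsCode L ι₁ V Γ)))) 1
            (W.subtype.baseChange ℂ t))) :
    ∀ σ : K →+* ℂ, σ ∈ Ψ.1 → (picardCMUniverse hHD hI h₁ h₃).Uiso Γ K Ψ σ ≠ ⊥ := by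
  classical
  obtain ⟨Φ, hΦ, hne⟩ := picardCMUniverse_exists_cmType_Uiso_ne_bot_of_allOrNothing_submodule
    (hHD := hHD) (hI := hI) hL Γ K W ρ hW
    (fun σ => if hσ : σ ∈ Ψ.1 then Or.inl (h10 σ hσ) else Or.inr (h01 σ hσ))
  have hΨΦ : Ψ = Φ := cmType_eq_of_subset fun σ hσ => (hΦ σ).2 (h10 σ hσ)
  subst hΨΦ
  exact hne

variable (hHD hI h₁ h₃) in
/-- **B01-S from Hodge blocks.**  If for every face datum `(F, f, ι₁, V)` — `F` a Galois CM field of degree `≥ 6`, `f` a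
rank-four face, `ι₁` admissible, `V` hermitian of the prescribed signature — some level `Γ` carries, in
`H¹(P_Γ(ℂ); ℚ)`, a Hodge block of type `(F; ψ₀)` and a Hodge block of type `(F; ψ₁)` (`ψᵢ = f.psi i`), then
`FaceSupply U_rec` holds: `U_{ψ₀}(Γ)_{ι₁} ≠ 0` and `U_{ψ₁}(Γ)_{ι₁} ≠ 0` by `picardCMUniverse_Uiso_ne_bot_of_hodgeBlock`,
since `ι₁ ∈ ψ₀ ∩ ψ₁` (`admissible_mem_psi`) and `2 < 6 ≤ [F:ℚ]`. -/
theorem picardCMUniverse_faceSupply_of_hodgeBlocks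
    (h : ∀ (F : CMField), IsGalois ℚ F → 6 ≤ Module.finrank ℚ F →
      ∀ (f : Face F) (ι₁ : F →+* ℂ), f.Admissible ι₁ → ∀ V : HermSpace3 F ι₁, ∃ Γ : Level V,
        ∀ i ∈ ({0, 1} : Finset (Fin 4)), ∃ (W : Submodule ℚ (bettiCohomology
            (Var.scheme (ballQuotientUniformisedDatum_of h₁) h₃ (.pms (pmsCode F ι₁ V Γ))) 1))
          (ρ : F →ₐ[ℚ] Module.End ℚ W), W ≠ ⊥ ∧
          (∀ σ : F →+* ℂ, σ ∈ (f.psi i).1 →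
            ∀ t : ℂ ⊗[ℚ] W, (∀ a : F, (ρ a).baseChange ℂ t = (σ a : ℂ) • t) →
              IsOfHodgeType 2 (Var.scheme (ballQuotientUniformisedDatum_of h₁) h₃ (.pms (pmsCode F ι₁ V Γ))) 1 1 0
                (ofRatClassBaseChange
                  (ComplexPoints (Var.scheme (ballQuotientUniformisedDatum_of h₁) h₃ (.pms (pmsCode F ι₁ V Γ)))) 1
                  (W.subtype.baseChange ℂ t))) ∧
          (∀ σ : F →+* ℂ, σ ∉ (f.psi i).1 →
            ∀ t : ℂ ⊗[ℚ] W, (∀ a : F, (ρ a).baseChange ℂ t = (σ a : ℂ) • t) →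
              IsOfHodgeType 2 (Var.scheme (ballQuotientUniformisedDatum_of h₁) h₃ (.pms (pmsCode F ι₁ V Γ))) 1 0 1
                (ofRatClassBaseChange
                  (ComplexPoints (Var.scheme (ballQuotientUniformisedDatum_of h₁) h₃ (.pms (pmsCode F ι₁ V Γ)))) 1
                  (W.subtype.baseChange ℂ t)))) :
    (picardCMUniverse hHD hI h₁ h₃).FaceSupply := by
  intro F hG h6 f ι₁ hι V
  obtain ⟨Γ, hΓ⟩ := h F hG h6 f ι₁ hι V
  have hF : 2 < Module.finrank ℚ F := by omega
  have hne : ∀ i ∈ ({0, 1} : Finset (Fin 4)), (picardCMUniverse hHD hI h₁ h₃).Uiso Γ F (f.psi i) ι₁ ≠ ⊥ :=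
      fun i hi => by
    obtain ⟨W, ρ, hW, h10, h01⟩ := hΓ i hi
    exact picardCMUniverse_Uiso_ne_bot_of_hodgeBlock hF Γ F (f.psi i) W ρ hW h10 h01 ι₁
      (admissible_mem_psi f ι₁ hι i)
  obtain ⟨ω₀, hω₀, hω₀ne⟩ := (Submodule.ne_bot_iff _).1 (hne 0 (by simp))
  obtain ⟨ω₁, hω₁, hω₁ne⟩ := (Submodule.ne_bot_iff _).1 (hne 1 (by simp))
  exact ⟨Γ, ω₀, ω₁, hω₀, hω₁, hω₀ne, hω₁ne⟩

variable (hHD hI h₁ h₃) in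
/-- **B01-S from Hodge blocks, slotwise.**  As `picardCMUniverse_faceSupply_of_hodgeBlocks`, but the Hodge block of type
`(F; ψ₀)` and the one of type `(F; ψ₁)` may sit at DIFFERENT levels `Γ₀`, `Γ₁` of the same `(ι₁, V)`: supply persists
down the tower to `Γ₀ ⊓ Γ₁` (b07's `faceSupply_iff_slotwise`, pull-back along the level covering is injective on the
`(1,0)`-part). -/
theorem picardCMUniverse_faceSupply_of_hodgeBlocks_slotwise
    (h : ∀ (F : CMField), IsGalois ℚ F → 6 ≤ Module.finrank ℚ F →
      ∀ (f : Face F) (ι₁ : F →+* ℂ), f.Admissible ι₁ → ∀ V : HermSpace3 F ι₁,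
        ∀ i ∈ ({0, 1} : Finset (Fin 4)), ∃ (Γ : Level V) (W : Submodule ℚ (bettiCohomology
            (Var.scheme (ballQuotientUniformisedDatum_of h₁) h₃ (.pms (pmsCode F ι₁ V Γ))) 1))
          (ρ : F →ₐ[ℚ] Module.End ℚ W), W ≠ ⊥ ∧
          (∀ σ : F →+* ℂ, σ ∈ (f.psi i).1 →
            ∀ t : ℂ ⊗[ℚ] W, (∀ a : F, (ρ a).baseChange ℂ t = (σ a : ℂ) • t) →
              IsOfHodgeType 2 (Var.scheme (ballQuotientUniformisedDatum_of h₁) h₃ (.pms (pmsCode F ι₁ V Γ))) 1 1 0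
                (ofRatClassBaseChange
                  (ComplexPoints (Var.scheme (ballQuotientUniformisedDatum_of h₁) h₃ (.pms (pmsCode F ι₁ V Γ)))) 1
                  (W.subtype.baseChange ℂ t))) ∧
          (∀ σ : F →+* ℂ, σ ∉ (f.psi i).1 →
            ∀ t : ℂ ⊗[ℚ] W, (∀ a : F, (ρ a).baseChange ℂ t = (σ a : ℂ) • t) →
              IsOfHodgeType 2 (Var.scheme (ballQuotientUniformisedDatum_of h₁) h₃ (.pms (pmsCode F ι₁ V Γ))) 1 0 1
                (ofRatClassBaseChange
                  (ComplexPoints (Var.scheme (ballQuotientUniformisedDatum_of h₁) h₃ (.pms (pmsCode F ι₁ V Γ)))) 1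
                  (W.subtype.baseChange ℂ t)))) :
    (picardCMUniverse hHD hI h₁ h₃).FaceSupply := by
  refine (faceSupply_iff_slotwise hHD hI h₁ h₃).2 fun F hG h6 f ι₁ hι V => ?_
  have hF : 2 < Module.finrank ℚ F := by omega
  have hne : ∀ i ∈ ({0, 1} : Finset (Fin 4)), ∃ (Γ : Level V)
      (ω : (picardCMUniverse hHD hI h₁ h₃).CohC ((picardCMUniverse hHD hI h₁ h₃).pms F ι₁ V Γ) 1),
      ω ∈ (picardCMUniverse hHD hI h₁ h₃).Uiso Γ F (f.psi i) ι₁ ∧ ω ≠ 0 := fun i hi => by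
    obtain ⟨Γ, W, ρ, hW, h10, h01⟩ := h F hG h6 f ι₁ hι V i hi
    obtain ⟨ω, hω, hωne⟩ := (Submodule.ne_bot_iff _).1
      (picardCMUniverse_Uiso_ne_bot_of_hodgeBlock hF Γ F (f.psi i) W ρ hW h10 h01 ι₁ (admissible_mem_psi f ι₁ hι i))
    exact ⟨Γ, ω, hω, hωne⟩
  exact ⟨hne 0 (by simp), hne 1 (by simp)⟩

/-- **Supply witnesses from Hodge blocks (the `∃ ι₁ ∃ V ∃ Γ` form of the transposition item (vi)).**  If for every
Galois CM field `F` of degree `≥ 6` and every face `f` there are an admissible `ι₁`, a hermitian `V` and ONE level `Γ`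
such that `H¹(P_Γ(ℂ); ℚ)` carries Hodge blocks of types `(F; ψ₀)` and `(F; ψ₁)`, then at that `(ι₁, V, Γ)` there are
non-zero classes `ω₀ ∈ U_{ψ₀}(Γ)_{ι₁}`, `ω₁ ∈ U_{ψ₁}(Γ)_{ι₁}` — the right-hand side of tr-prover-6's
`faceThetaSupplyWedgeExists_iff_exists_supply`, stated inline (nothing of `Transposition/*` imported or restated). -/
theorem picardCMUniverse_exists_supply_of_hodgeBlocks
    (h : ∀ (F : CMField), IsGalois ℚ F → 6 ≤ Module.finrank ℚ F → ∀ f : Face F,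
      ∃ (ι₁ : F →+* ℂ) (_ : f.Admissible ι₁) (V : HermSpace3 F ι₁) (Γ : Level V),
        ∀ i ∈ ({0, 1} : Finset (Fin 4)), ∃ (W : Submodule ℚ (bettiCohomology
            (Var.scheme (ballQuotientUniformisedDatum_of h₁) h₃ (.pms (pmsCode F ι₁ V Γ))) 1))
          (ρ : F →ₐ[ℚ] Module.End ℚ W), W ≠ ⊥ ∧
          (∀ σ : F →+* ℂ, σ ∈ (f.psi i).1 →
            ∀ t : ℂ ⊗[ℚ] W, (∀ a : F, (ρ a).baseChange ℂ t = (σ a : ℂ) • t) →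
              IsOfHodgeType 2 (Var.scheme (ballQuotientUniformisedDatum_of h₁) h₃ (.pms (pmsCode F ι₁ V Γ))) 1 1 0
                (ofRatClassBaseChange
                  (ComplexPoints (Var.scheme (ballQuotientUniformisedDatum_of h₁) h₃ (.pms (pmsCode F ι₁ V Γ)))) 1
                  (W.subtype.baseChange ℂ t))) ∧
          (∀ σ : F →+* ℂ, σ ∉ (f.psi i).1 →
            ∀ t : ℂ ⊗[ℚ] W, (∀ a : F, (ρ a).baseChange ℂ t = (σ a : ℂ) • t) →
              IsOfHodgeType 2 (Var.scheme (ballQuotientUniformisedDatum_of h₁) h₃ (.pms (pmsCode F ι₁ V Γ))) 1 0 1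
                (ofRatClassBaseChange
                  (ComplexPoints (Var.scheme (ballQuotientUniformisedDatum_of h₁) h₃ (.pms (pmsCode F ι₁ V Γ)))) 1
                  (W.subtype.baseChange ℂ t)))) :
    ∀ (F : CMField), IsGalois ℚ F → 6 ≤ Module.finrank ℚ F → ∀ f : Face F,
      ∃ (ι₁ : F →+* ℂ) (_ : f.Admissible ι₁) (V : HermSpace3 F ι₁) (Γ : Level V)
        (ω₀ ω₁ : (picardCMUniverse hHD hI h₁ h₃).CohC ((picardCMUniverse hHD hI h₁ h₃).pms F ι₁ V Γ) 1),
        ω₀ ∈ (picardCMUniverse hHD hI h₁ h₃).Uiso Γ F (f.psi 0) ι₁ ∧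
          ω₁ ∈ (picardCMUniverse hHD hI h₁ h₃).Uiso Γ F (f.psi 1) ι₁ ∧ ω₀ ≠ 0 ∧ ω₁ ≠ 0 := by
  intro F hG h6 f
  obtain ⟨ι₁, hι, V, Γ, hΓ⟩ := h F hG h6 f
  have hF : 2 < Module.finrank ℚ F := by omega
  have hne : ∀ i ∈ ({0, 1} : Finset (Fin 4)), (picardCMUniverse hHD hI h₁ h₃).Uiso Γ F (f.psi i) ι₁ ≠ ⊥ :=
      fun i hi => by
    obtain ⟨W, ρ, hW, h10, h01⟩ := hΓ i hi
    exact picardCMUniverse_Uiso_ne_bot_of_hodgeBlock hF Γ F (f.psi i) W ρ hW h10 h01 ι₁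
      (admissible_mem_psi f ι₁ hι i)
  obtain ⟨ω₀, hω₀, hω₀ne⟩ := (Submodule.ne_bot_iff _).1 (hne 0 (by simp))
  obtain ⟨ω₁, hω₁, hω₁ne⟩ := (Submodule.ne_bot_iff _).1 (hne 1 (by simp))
  exact ⟨ι₁, hι, V, Γ, ω₀, ω₁, hω₀, hω₁, hω₀ne, hω₁ne⟩

end Model

end Summit.HodgeConjecture.CorCM

end
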